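import Summits.QuantumFields.YangMills.Theorems.ScalingWindowSplitSelfNormalisedSkewnessWitnessSmearingTwo
import Summits.QuantumFields.YangMills.Theorems.ScalingWindowSplitSelfNormalisedSkewnessWitnessScheme
import Summits.QuantumFields.YangMills.Theorems.ScalingWindowSplitSelfNormalisedSkewnessWitnessBump
import HarnessLib

/-!
# `SelfNormalisedSkewness` — negative side: asymptotics of the `U(1)` witness along `swScheme 96`

Route `ScalingWindowSplit`, crux `stmt-QuantumFields-18944`, line `Sketch` (negation branch), support for the
lead's `stub_witnessAssembly`.  Along the witness scheme (`n = k+1`, `a = 1/n`, `β = n^{96}`, `L = n²`,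
`ε = n^{-43}`): eventually all smallness conditions of the fixed-step estimates hold
(`scheme_admissible`); the crux's `T_k(w)` is of exact order `n^{-200}` for the bump and its time shift
(`cruxT_lower_eventually`, `cruxT_upper_eventually`); and the bare smeared third moment is
`O(n^{-300} n^{-1/2})` (`cm3_witness_eventually`).

References: Lüscher 1999 §3; standard.  No definitions of propositions, no named facts.
-/

noncomputable section

open scoped BigOperators ENNReal InnerProductSpace
open MeasureTheory ProbabilityTheory Filter Topology
open Literature.MathematicalPhysics.QuantumLattice Literature.MathematicalPhysics.QuantumFieldTheory
open Literature.Probability.LatticeModels (box)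

namespace Summit.QuantumFields.YangMills.Theorems.SelfNormalisedSkewness.Negative

/-! ### Admissibility of the scheme, eventually -/

/-- The Gaussian tail along the scheme: `γ{∃p, n⁵ ≤ |v_p|} ≤ 486 C₂ n^{-22}`. [folklore] -/
theorem gaussTail_le : ∃ C : ℝ, 0 < C ∧ ∀ k : ℕ,
    (stdGaussian (LinearMap.range (plaqCoboundary (2 * (k + 1) ^ (2 : ℕ) + 1)))).real
        {w | ∃ p, epsW k * Real.sqrt (nR k ^ 96) ≤ |⟪frameV (2 * (k + 1) ^ (2 : ℕ) + 1) p, w⟫_ℝ|} ≤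
      C * (nR k ^ 22)⁻¹ := by
  obtain ⟨C₂, hC₂0, hW⟩ := stub_parsevalGaussianMoments
  refine ⟨486 * C₂, by positivity, fun k => ?_⟩
  have h := (hW (frameV (2 * (k + 1) ^ (2 : ℕ) + 1)) sum_sq_inner_frameV ∅ ∅ ∅ (by simp) (by simp) (by simp)).2.2.2.2.2.2
    (epsW k * Real.sqrt (nR k ^ 96)) (one_le_eps_mul_sqrt_beta k)
  refine h.1.trans ?_
  have hc := card_tail_le k
  calc C₂ * (Fintype.card (Plaquette 4 (2 * (k + 1) ^ (2 : ℕ) + 1)) : ℝ) * (epsW k * Real.sqrt (nR k ^ 96))⁻¹ ^ 6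
      = C₂ * ((Fintype.card (Plaquette 4 (2 * (k + 1) ^ (2 : ℕ) + 1)) : ℝ) * (epsW k * Real.sqrt (nR k ^ 96))⁻¹ ^ 6) := by
        ring
    _ ≤ C₂ * (486 * (nR k ^ 22)⁻¹) := mul_le_mul_of_nonneg_left hc hC₂0.le
    _ = 486 * C₂ * (nR k ^ 22)⁻¹ := by ring

/-- **Eventually the fixed-step estimates apply**: `S⁴ε ≤ 2π`, `β #P ε⁴ ≤ 1`, `#P (ε√β)^{-6} ≤ 1`, Gaussian
tail `≤ ½`. [folklore] -/
theorem scheme_admissible : ∀ᶠ k in atTop,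
    ((2 * (k + 1) ^ (2 : ℕ) + 1 : ℕ) : ℝ) ^ 4 * epsW k ≤ 2 * Real.pi ∧
    nR k ^ 96 * Fintype.card (Plaquette 4 (2 * (k + 1) ^ (2 : ℕ) + 1)) * epsW k ^ 4 ≤ 1 ∧
    Fintype.card (Plaquette 4 (2 * (k + 1) ^ (2 : ℕ) + 1)) * (epsW k * Real.sqrt (nR k ^ 96))⁻¹ ^ 6 ≤ 1 ∧
    (stdGaussian (LinearMap.range (plaqCoboundary (2 * (k + 1) ^ (2 : ℕ) + 1)))).real
        {w | ∃ p, epsW k * Real.sqrt (nR k ^ 96) ≤ |⟪frameV (2 * (k + 1) ^ (2 : ℕ) + 1) p, w⟫_ℝ|} ≤ 1 / 2 := by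
  obtain ⟨C, hC0, hC⟩ := gaussTail_le
  filter_upwards [eventually_const_mul_inv_pow_le 81 (m := 35) (by norm_num) Real.two_pi_pos,
    eventually_const_mul_inv_pow_le 486 (m := 68) (by norm_num) one_pos,
    eventually_const_mul_inv_pow_le 486 (m := 22) (by norm_num) one_pos,
    eventually_const_mul_inv_pow_le C (m := 22) (by norm_num) (by norm_num : (0 : ℝ) < 1 / 2)]
    with k h1 h2 h3 h4
  exact ⟨(side_pow_four_mul_eps_le k).trans h1, (beta_card_eps_four_le k).trans h2, (card_tail_le k).trans h3,
    (hC k).trans h4⟩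

/-- `a_k² L_k = 1`. [folklore] -/
theorem a_sq_mul_L (k : ℕ) : (nR k)⁻¹ ^ 2 * (((k + 1) ^ (2 : ℕ) : ℕ) : ℝ) = 1 := by
  rw [nR_eq_cast]; push_cast; field_simp

/-- `a_k ≤ 1`. [folklore] -/
theorem a_le_one (k : ℕ) : (nR k)⁻¹ ≤ 1 := inv_le_one_of_one_le₀ (one_le_nR k)

/-- `0 < a_k`. [folklore] -/
theorem a_pos' (k : ℕ) : 0 < (nR k)⁻¹ := inv_pos.2 (nR_pos k)

/-- The error scale of the two-point function: `η + ε⁶ + β⁻²ξ ≤ 974 n^{-214}` eventually. [folklore] -/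
theorem err2_eventually : ∀ᶠ k in atTop,
    (wilsonMeasure u1Rep (nR k ^ 96) : Measure (GaugeConfig 4 (2 * (k + 1) ^ (2 : ℕ) + 1) Circle)).real
        {U | ∀ p : Plaquette 4 (2 * (k + 1) ^ (2 : ℕ) + 1), |plaqAngle U p| < epsW k}ᶜ +
      epsW k ^ 6 + (nR k ^ 96)⁻¹ ^ 2 * (nR k ^ 96 * Fintype.card (Plaquette 4 (2 * (k + 1) ^ (2 : ℕ) + 1)) * epsW k ^ 4 +
        Fintype.card (Plaquette 4 (2 * (k + 1) ^ (2 : ℕ) + 1)) * (epsW k * Real.sqrt (nR k ^ 96))⁻¹ ^ 6) ≤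
      974 * (nR k ^ 214)⁻¹ := by
  filter_upwards [eta_eventually_le] with k hη
  have hn := nR_pos k
  have hn1 := one_le_nR k
  have h1 : (nR k ^ 312)⁻¹ ≤ (nR k ^ 214)⁻¹ :=
    inv_anti₀ (pow_pos hn _) (pow_le_pow_right₀ hn1 (by norm_num))
  have h2 : epsW k ^ 6 ≤ (nR k ^ 214)⁻¹ := by
    unfold epsW; rw [inv_pow, ← pow_mul]
    exact inv_anti₀ (pow_pos hn _) (pow_le_pow_right₀ hn1 (by norm_num))
  have h3 : (nR k ^ 96)⁻¹ ^ 2 * (nR k ^ 96 * Fintype.card (Plaquette 4 (2 * (k + 1) ^ (2 : ℕ) + 1)) * epsW k ^ 4 +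
      Fintype.card (Plaquette 4 (2 * (k + 1) ^ (2 : ℕ) + 1)) * (epsW k * Real.sqrt (nR k ^ 96))⁻¹ ^ 6) ≤
      972 * (nR k ^ 214)⁻¹ := by
    have hw := beta_card_eps_four_le k
    have hτ := card_tail_le k
    have hs : nR k ^ 96 * Fintype.card (Plaquette 4 (2 * (k + 1) ^ (2 : ℕ) + 1)) * epsW k ^ 4 +
        Fintype.card (Plaquette 4 (2 * (k + 1) ^ (2 : ℕ) + 1)) * (epsW k * Real.sqrt (nR k ^ 96))⁻¹ ^ 6 ≤
        972 * (nR k ^ 22)⁻¹ := by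
      have : (nR k ^ 68)⁻¹ ≤ (nR k ^ 22)⁻¹ := inv_anti₀ (pow_pos hn _) (pow_le_pow_right₀ hn1 (by norm_num))
      linarith
    calc (nR k ^ 96)⁻¹ ^ 2 * (nR k ^ 96 * Fintype.card (Plaquette 4 (2 * (k + 1) ^ (2 : ℕ) + 1)) * epsW k ^ 4 +
          Fintype.card (Plaquette 4 (2 * (k + 1) ^ (2 : ℕ) + 1)) * (epsW k * Real.sqrt (nR k ^ 96))⁻¹ ^ 6)
        ≤ (nR k ^ 96)⁻¹ ^ 2 * (972 * (nR k ^ 22)⁻¹) := mul_le_mul_of_nonneg_left hs (by positivity)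
      _ = 972 * (nR k ^ 214)⁻¹ := by field_simp
  linarith

/-! ### The two-point function along the scheme -/

/-- **Lower bound for `T_k(w)`**: for a past-supported test `w ≥ 0` which is `≥ 1` on the ball of radius
`bumpR` around `−t₀e₀` with `bumpR ≤ δ₁ t₀`, eventually `c n^{-200} ≤ T_k(w)` for some `c > 0`. [folklore] -/
theorem cruxT_lower_eventually (w : SchwartzMap E4 ℝ) (hwneg : tsupport w ⊆ {y : E4 | y 0 < 0})
    (hw0 : ∀ y, 0 ≤ w y) {t₀ : ℝ} (ht₀ : bumpR ≤ tpDelta * t₀)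
    (hball : ∀ y : E4, dist y (EuclideanSpace.single (0 : Fin 4) (-t₀)) ≤ bumpR → 1 ≤ w y) :
    ∃ c : ℝ, 0 < c ∧ ∀ᶠ k in atTop, c * (nR k ^ 200)⁻¹ ≤ cruxT u1LatticeRep (swScheme 96) w k := by
  obtain ⟨K, hK0, hK⟩ := smeared_cm2_bound w hwneg
  obtain ⟨c, a₀, hc, ha₀, hTP⟩ := tpDelta_spec.2 w t₀ bumpR bumpR_pos ht₀ hw0 hball
  refine ⟨c / 4, by positivity, ?_⟩
  have hev_a : ∀ᶠ k : ℕ in atTop, (nR k)⁻¹ ≤ a₀ := by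
    have := eventually_const_mul_inv_pow_le 1 (m := 1) le_rfl ha₀
    refine this.mono fun k hk => ?_
    simpa using hk
  filter_upwards [scheme_admissible, err2_eventually, hev_a,
    eventually_const_mul_inv_pow_le (974 * K) (m := 14) (by norm_num) (by positivity : 0 < c / 4)]
    with k hadm herr ha₀k hsmall
  obtain ⟨hSε, hw4, hτ, htail⟩ := hadm
  have hn := nR_pos k
  -- the fixed-step estimate at step k
  have hb := hK ((k + 1) ^ (2 : ℕ)) ((nR k)⁻¹) (nR k ^ 96) (epsW k) (a_pos' k) (a_le_one k) (pow_pos hn 96)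
    (epsK_pos k) (epsK_le_one k) hSε (one_le_eps_mul_sqrt_beta k) hw4 hτ htail
  -- the cone lower bound for the main term
  have hmain := hTP ((nR k)⁻¹) (a_pos' k) ha₀k ((k + 1) ^ (2 : ℕ)) (a_sq_mul_L k)
    (maxwellH (2 * (k + 1) ^ (2 : ℕ) + 1)) maxwellH_spec (maxwellK (2 * (k + 1) ^ (2 : ℕ) + 1)) maxwellK_spec
  -- identify `cruxT`
  have hT := cruxT_witness_eq w k
  simp only [PhiW] at hT
  have hnR : ((k : ℝ) + 1) = nR k := rfl
  rw [hnR] at hT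
  rw [hT]
  -- sizes
  have ha8 : (nR k)⁻¹ ^ 8 * ((nR k ^ 96)⁻¹ ^ 2 / 2) = (nR k ^ 200)⁻¹ / 2 := by field_simp
  have hpos : 0 ≤ (nR k)⁻¹ ^ 8 * ((nR k ^ 96)⁻¹ ^ 2 / 2) := by positivity
  have hlow := mul_le_mul_of_nonneg_left hmain hpos
  rw [ha8] at hlow hb
  -- `T ≥ main − err ≥ a⁸b²c/2 − K·err2 ≥ (c/4) n^{-200}`
  have herrK : K * ((wilsonMeasure u1Rep (nR k ^ 96) :
        Measure (GaugeConfig 4 (2 * (k + 1) ^ (2 : ℕ) + 1) Circle)).real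
        {U | ∀ p : Plaquette 4 (2 * (k + 1) ^ (2 : ℕ) + 1), |plaqAngle U p| < epsW k}ᶜ +
      epsW k ^ 6 + (nR k ^ 96)⁻¹ ^ 2 * (nR k ^ 96 * Fintype.card (Plaquette 4 (2 * (k + 1) ^ (2 : ℕ) + 1)) * epsW k ^ 4 +
        Fintype.card (Plaquette 4 (2 * (k + 1) ^ (2 : ℕ) + 1)) * (epsW k * Real.sqrt (nR k ^ 96))⁻¹ ^ 6)) ≤
      (c / 4) * (nR k ^ 200)⁻¹ := by
    refine (mul_le_mul_of_nonneg_left herr hK0).trans ?_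
    have e : K * (974 * (nR k ^ 214)⁻¹) = 974 * K * (nR k ^ 14)⁻¹ * (nR k ^ 200)⁻¹ := by field_simp
    rw [e]
    exact mul_le_mul_of_nonneg_right hsmall (by positivity)
  have hb' := (abs_le.1 hb).1
  linarith [hlow, herrK, hb']

/-- **Upper bound for `T_k(bumpU)`**: eventually `T_k(u) ≤ C n^{-200}`. [folklore] -/
theorem cruxT_upper_eventually :
    ∃ C : ℝ, 0 < C ∧ ∀ᶠ k in atTop, cruxT u1LatticeRep (swScheme 96) bumpU k ≤ C * (nR k ^ 200)⁻¹ := by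
  obtain ⟨K, hK0, hK⟩ := smeared_cm2_bound bumpU tsupport_bumpU_subset_neg
  obtain ⟨CU, hCU⟩ := stub_twoPointSmearing.1 bumpU 3 1 one_pos
    (fun y hy => by have := tsupport_bumpU_subset_le hy; simpa using this) tsupport_bumpU_subset_ball
  refine ⟨max CU 0 / 2 + 1, by positivity, ?_⟩
  have hev_a : ∀ᶠ k : ℕ in atTop, 2 * (nR k)⁻¹ * 3 ≤ 1 := by
    have := eventually_const_mul_inv_pow_le 6 (m := 1) le_rfl one_pos
    refine this.mono fun k hk => ?_
    have e : 2 * (nR k)⁻¹ * 3 = 6 * (nR k ^ 1)⁻¹ := by rw [pow_one]; ring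
    rw [e]; exact hk
  filter_upwards [scheme_admissible, err2_eventually, hev_a,
    eventually_const_mul_inv_pow_le (974 * K) (m := 14) (by norm_num) one_pos] with k hadm herr ha3 hsmall
  obtain ⟨hSε, hw4, hτ, htail⟩ := hadm
  have hn := nR_pos k
  have hb := hK ((k + 1) ^ (2 : ℕ)) ((nR k)⁻¹) (nR k ^ 96) (epsW k) (a_pos' k) (a_le_one k) (pow_pos hn 96)
    (epsK_pos k) (epsK_le_one k) hSε (one_le_eps_mul_sqrt_beta k) hw4 hτ htail
  have hmain := hCU ((nR k)⁻¹) (a_pos' k) (a_le_one k) ha3 ((k + 1) ^ (2 : ℕ)) (a_sq_mul_L k)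
    (maxwellH (2 * (k + 1) ^ (2 : ℕ) + 1)) maxwellH_spec (maxwellK (2 * (k + 1) ^ (2 : ℕ) + 1)) maxwellK_spec
  have hT := cruxT_witness_eq bumpU k
  simp only [PhiW] at hT
  have hnR : ((k : ℝ) + 1) = nR k := rfl
  rw [hnR] at hT
  rw [hT]
  have ha8 : (nR k)⁻¹ ^ 8 * ((nR k ^ 96)⁻¹ ^ 2 / 2) = (nR k ^ 200)⁻¹ / 2 := by field_simp
  have hpos : 0 ≤ (nR k)⁻¹ ^ 8 * ((nR k ^ 96)⁻¹ ^ 2 / 2) := by positivity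
  have hup := mul_le_mul_of_nonneg_left (hmain.trans (le_max_left CU 0)) hpos
  rw [ha8] at hup hb
  have herrK : K * ((wilsonMeasure u1Rep (nR k ^ 96) :
        Measure (GaugeConfig 4 (2 * (k + 1) ^ (2 : ℕ) + 1) Circle)).real
        {U | ∀ p : Plaquette 4 (2 * (k + 1) ^ (2 : ℕ) + 1), |plaqAngle U p| < epsW k}ᶜ +
      epsW k ^ 6 + (nR k ^ 96)⁻¹ ^ 2 * (nR k ^ 96 * Fintype.card (Plaquette 4 (2 * (k + 1) ^ (2 : ℕ) + 1)) * epsW k ^ 4 +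
        Fintype.card (Plaquette 4 (2 * (k + 1) ^ (2 : ℕ) + 1)) * (epsW k * Real.sqrt (nR k ^ 96))⁻¹ ^ 6)) ≤
      (nR k ^ 200)⁻¹ := by
    refine (mul_le_mul_of_nonneg_left herr hK0).trans ?_
    have e : K * (974 * (nR k ^ 214)⁻¹) = 974 * K * (nR k ^ 14)⁻¹ * (nR k ^ 200)⁻¹ := by field_simp
    rw [e]
    calc 974 * K * (nR k ^ 14)⁻¹ * (nR k ^ 200)⁻¹ ≤ 1 * (nR k ^ 200)⁻¹ :=
          mul_le_mul_of_nonneg_right hsmall (by positivity)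
      _ = (nR k ^ 200)⁻¹ := one_mul _
  have hb' := (abs_le.1 hb).2
  have hmax : 0 ≤ max CU 0 := le_max_right _ _
  have hq : 0 ≤ (nR k ^ 200)⁻¹ := inv_nonneg.2 (pow_nonneg hn.le 200)
  have e : (max CU 0 / 2 + 1) * (nR k ^ 200)⁻¹ = (nR k ^ 200)⁻¹ / 2 * max CU 0 + (nR k ^ 200)⁻¹ := by ring
  rw [e]
  linarith [hup, herrK, hb']

end Summit.QuantumFields.YangMills.Theorems.SelfNormalisedSkewness.Negative

end
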